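import Summits.QuantumFields.YangMills.Theorems.HyperbolicRegulatorCurvatureAnchorRStubKunnethHodge

/-!
# Stub `stub_kunneth` of line `witten_hessian` (crux `CurvatureAnchorR`, stmt-QuantumFields-18155), part 3: the product step

From the Hodge gap of one factor (`Kunneth.hodge_gap`, constant `c₀ = 10⁶ k²`) to the
Künneth–Poincaré gap `KunnethGap k` of the product complex `S × S` (constant `10⁷ k²`):

* `Kunneth.block_bound` — for a "matrix" cochain `w e y` (an `E × V` block of a product 1-cochain)
  the vertex-slot average `w̄` has a harmonic part `hA` (factor Hodge gap) with
  `∑_E ∑_V (w − hA)² ≤ c₀ (∑∑ (d₀ʸ w)² + ∑∑ (d₀*ₑ w)² + ∑∑ (d₁ₑ w)²)`: mean/variance splitting in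
  the vertex slot, `Poinc` for the fluctuation, `hodge_gap` + Jensen for the average;
* `Kunneth.cross_eq` — the Künneth identity: the cross terms of `‖d₀* ω‖²` (vertex × vertex) and of
  `‖d_C ω‖²` (edge × edge) agree, by the adjunction `sum_mul_dv0` applied once in each slot;
* `Kunneth.product_main` — assembly: `Nm (ω − h) ≤ 10⁷ k² · Dir ω` with `h` constant in the vertex
  slots, everything spelled exactly as the `let`s of `KunnethGap` unfold;
* `stub_kunneth` — the registered stub, by unfolding `KunnethGap`.
-/

set_option autoImplicit false

namespace Summit.QuantumFields.YangMills.Cruxes.CurvatureAnchorR.WittenHessian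

open scoped BigOperators Classical

namespace Kunneth

/-- **One block of the product estimate.**  For a matrix cochain `w : E × V → ℝ` there is a
harmonic `hA` on the factor with `∑_E ∑_V (w e y − hA e)² ≤ 10⁶k² (∑_e ∑_e' (w e (σ e') − w e (τ e'))²
+ ∑_x ∑_y (d₀*(w · y) x)² + ∑_q ∑_y (d₁ (w · y) q)²)`. -/
theorem block_bound {k : ℕ} {V E Q : Finset ℕ} {σ τ : ℕ → ℕ} {bd : ℕ → Fin 4 → ℕ × Bool}
    (hS : SqCx V E Q σ τ bd) (hP : Poinc k V E σ τ) (hC : Coh Q bd) (hD : DualPoinc k E Q bd)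
    (w : ℕ → ℕ → ℝ) :
    ∃ hA : ℕ → ℝ,
      (∀ x ∈ V, (∑ e ∈ E.filter (fun e => τ e = x), hA e) -
        (∑ e ∈ E.filter (fun e => σ e = x), hA e) = 0) ∧
      (∀ q ∈ Q, ∑ i : Fin 4, (if (bd q i).2 then (1 : ℝ) else -1) * hA (bd q i).1 = 0) ∧
      ∑ e ∈ E, ∑ y ∈ V, (w e y - hA e) ^ 2 ≤ 10 ^ 6 * (k : ℝ) ^ 2 *
        ((∑ e ∈ E, ∑ e' ∈ E, (w e (σ e') - w e (τ e')) ^ 2) +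
          (∑ x ∈ V, ∑ y ∈ V, ((∑ e ∈ E.filter (fun e => τ e = x), w e y) -
            (∑ e ∈ E.filter (fun e => σ e = x), w e y)) ^ 2) +
          ∑ q ∈ Q, ∑ y ∈ V, (∑ i : Fin 4, (if (bd q i).2 then (1 : ℝ) else -1) * w (bd q i).1 y) ^ 2) := by
  have c0 : (0 : ℝ) ≤ 10 ^ 6 * (k : ℝ) ^ 2 := by positivity
  obtain ⟨hA, hd, hc, hb⟩ := hodge_gap hS hP hC hD fun e => (∑ y ∈ V, w e y) / V.card
  refine ⟨hA, hd, hc, ?_⟩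
  -- mean/variance splitting in the vertex slot
  have hdec : ∑ e ∈ E, ∑ y ∈ V, (w e y - hA e) ^ 2 =
      (∑ e ∈ E, ∑ y ∈ V, (w e y - (∑ j ∈ V, w e j) / V.card) ^ 2) +
        V.card * ∑ e ∈ E, ((∑ j ∈ V, w e j) / V.card - hA e) ^ 2 := by
    rw [Finset.mul_sum, ← Finset.sum_add_distrib]
    exact Finset.sum_congr rfl fun e _ => sum_sq_sub_eq V (w e) (hA e)
  -- (i) the fluctuation, by `Poinc` in the vertex slot
  have h1 : ∑ e ∈ E, ∑ y ∈ V, (w e y - (∑ j ∈ V, w e j) / V.card) ^ 2 ≤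
      10 ^ 6 * (k : ℝ) ^ 2 * ∑ e ∈ E, ∑ e' ∈ E, (w e (σ e') - w e (τ e')) ^ 2 := by
    rw [Finset.mul_sum]
    refine Finset.sum_le_sum fun e _ => ?_
    refine (hP (fun y => w e y - (∑ j ∈ V, w e j) / V.card) (sum_sub_mean V (w e))).trans
      (le_of_eq ?_)
    congr 1
    refine Finset.sum_congr rfl fun e' _ => ?_
    ring
  -- (ii) the average, by the factor Hodge gap and Jensen
  have h2 : (V.card : ℝ) * ∑ e ∈ E, ((∑ j ∈ V, w e j) / V.card - hA e) ^ 2 ≤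
      10 ^ 6 * (k : ℝ) ^ 2 *
        ((∑ x ∈ V, ∑ y ∈ V, ((∑ e ∈ E.filter (fun e => τ e = x), w e y) -
            (∑ e ∈ E.filter (fun e => σ e = x), w e y)) ^ 2) +
          ∑ q ∈ Q, ∑ y ∈ V,
            (∑ i : Fin 4, (if (bd q i).2 then (1 : ℝ) else -1) * w (bd q i).1 y) ^ 2) := by
    have hn0 : (0 : ℝ) ≤ V.card := Nat.cast_nonneg _
    calc (V.card : ℝ) * ∑ e ∈ E, ((∑ j ∈ V, w e j) / V.card - hA e) ^ 2
        ≤ V.card * (10 ^ 6 * (k : ℝ) ^ 2 *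
            ((∑ x ∈ V, ((∑ e ∈ E.filter (fun e => τ e = x), (∑ j ∈ V, w e j) / (V.card : ℝ)) -
                (∑ e ∈ E.filter (fun e => σ e = x), (∑ j ∈ V, w e j) / (V.card : ℝ))) ^ 2) +
              ∑ q ∈ Q, (∑ i : Fin 4, (if (bd q i).2 then (1 : ℝ) else -1) *
                ((∑ j ∈ V, w (bd q i).1 j) / (V.card : ℝ))) ^ 2)) :=
          mul_le_mul_of_nonneg_left hb hn0
      _ = 10 ^ 6 * (k : ℝ) ^ 2 *
            ((∑ x ∈ V, V.card *
                ((∑ e ∈ E.filter (fun e => τ e = x), (∑ j ∈ V, w e j) / (V.card : ℝ)) -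
                  (∑ e ∈ E.filter (fun e => σ e = x), (∑ j ∈ V, w e j) / (V.card : ℝ))) ^ 2) +
              ∑ q ∈ Q, V.card * (∑ i : Fin 4, (if (bd q i).2 then (1 : ℝ) else -1) *
                ((∑ j ∈ V, w (bd q i).1 j) / (V.card : ℝ))) ^ 2) := by
          rw [← Finset.mul_sum, ← Finset.mul_sum]
          ring
      _ ≤ _ := by
          refine mul_le_mul_of_nonneg_left (add_le_add ?_ ?_) c0
          · refine Finset.sum_le_sum fun x _ => ?_
            rw [dv0_avg E V σ τ w x]
            exact card_mul_sq_div_le V _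
          · refine Finset.sum_le_sum fun q _ => ?_
            rw [curl_avg V bd w q]
            exact card_mul_sq_div_le V _
  rw [hdec]
  calc _ ≤ 10 ^ 6 * (k : ℝ) ^ 2 * (∑ e ∈ E, ∑ e' ∈ E, (w e (σ e') - w e (τ e')) ^ 2) +
        10 ^ 6 * (k : ℝ) ^ 2 *
          ((∑ x ∈ V, ∑ y ∈ V, ((∑ e ∈ E.filter (fun e => τ e = x), w e y) -
              (∑ e ∈ E.filter (fun e => σ e = x), w e y)) ^ 2) +
            ∑ q ∈ Q, ∑ y ∈ V,
              (∑ i : Fin 4, (if (bd q i).2 then (1 : ℝ) else -1) * w (bd q i).1 y) ^ 2) :=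
        add_le_add h1 h2
    _ = _ := by ring

/-- **The Künneth identity of the cross terms.**  With `a x y = d₀*(ω(inl(·, y))) x`,
`b x y = d₀*(ω(inr(x, ·))) y`, `c e e' = ω(inl(e, τ e')) − ω(inl(e, σ e'))`,
`d e e' = ω(inr(τ e, e')) − ω(inr(σ e, e'))`: `∑_V ∑_V a·b = ∑_E ∑_E c·d`. -/
theorem cross_eq {V E : Finset ℕ} {σ τ : ℕ → ℕ} (hE : ∀ e ∈ E, σ e ∈ V ∧ τ e ∈ V)
    (ω : (ℕ × ℕ) ⊕ (ℕ × ℕ) → ℝ) :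
    ∑ x ∈ V, ∑ y ∈ V,
        ((∑ e ∈ E.filter (fun e => τ e = x), ω (Sum.inl (e, y))) -
            (∑ e ∈ E.filter (fun e => σ e = x), ω (Sum.inl (e, y)))) *
          ((∑ e ∈ E.filter (fun e => τ e = y), ω (Sum.inr (x, e))) -
            (∑ e ∈ E.filter (fun e => σ e = y), ω (Sum.inr (x, e)))) =
      ∑ e ∈ E, ∑ e' ∈ E, (ω (Sum.inl (e, τ e')) - ω (Sum.inl (e, σ e'))) *
        (ω (Sum.inr (τ e, e')) - ω (Sum.inr (σ e, e'))) := by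
  calc ∑ x ∈ V, ∑ y ∈ V,
        ((∑ e ∈ E.filter (fun e => τ e = x), ω (Sum.inl (e, y))) -
            (∑ e ∈ E.filter (fun e => σ e = x), ω (Sum.inl (e, y)))) *
          ((∑ e ∈ E.filter (fun e => τ e = y), ω (Sum.inr (x, e))) -
            (∑ e ∈ E.filter (fun e => σ e = y), ω (Sum.inr (x, e))))
      = ∑ y ∈ V, ∑ x ∈ V,
          ((∑ e ∈ E.filter (fun e => τ e = y), ω (Sum.inr (x, e))) -
              (∑ e ∈ E.filter (fun e => σ e = y), ω (Sum.inr (x, e)))) *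
            ((∑ e ∈ E.filter (fun e => τ e = x), ω (Sum.inl (e, y))) -
              (∑ e ∈ E.filter (fun e => σ e = x), ω (Sum.inl (e, y)))) := by
        rw [Finset.sum_comm]
        exact Finset.sum_congr rfl fun y _ => Finset.sum_congr rfl fun x _ => mul_comm _ _
    _ = ∑ y ∈ V, ∑ e ∈ E, ω (Sum.inl (e, y)) *
          (((∑ e' ∈ E.filter (fun e' => τ e' = y), ω (Sum.inr (τ e, e'))) -
              (∑ e' ∈ E.filter (fun e' => σ e' = y), ω (Sum.inr (τ e, e')))) -
            ((∑ e' ∈ E.filter (fun e' => τ e' = y), ω (Sum.inr (σ e, e'))) -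
              (∑ e' ∈ E.filter (fun e' => σ e' = y), ω (Sum.inr (σ e, e'))))) :=
        Finset.sum_congr rfl fun y _ =>
          sum_mul_dv0 hE
            (fun x => (∑ e' ∈ E.filter (fun e' => τ e' = y), ω (Sum.inr (x, e'))) -
              (∑ e' ∈ E.filter (fun e' => σ e' = y), ω (Sum.inr (x, e'))))
            (fun e => ω (Sum.inl (e, y)))
    _ = ∑ y ∈ V, ∑ e ∈ E, ω (Sum.inl (e, y)) *
          ((∑ e' ∈ E.filter (fun e' => τ e' = y), (ω (Sum.inr (τ e, e')) - ω (Sum.inr (σ e, e')))) -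
            (∑ e' ∈ E.filter (fun e' => σ e' = y), (ω (Sum.inr (τ e, e')) - ω (Sum.inr (σ e, e'))))) := by
        refine Finset.sum_congr rfl fun y _ => Finset.sum_congr rfl fun e _ => ?_
        rw [Finset.sum_sub_distrib, Finset.sum_sub_distrib]
        ring
    _ = ∑ e ∈ E, ∑ y ∈ V, ω (Sum.inl (e, y)) *
          ((∑ e' ∈ E.filter (fun e' => τ e' = y), (ω (Sum.inr (τ e, e')) - ω (Sum.inr (σ e, e')))) -
            (∑ e' ∈ E.filter (fun e' => σ e' = y), (ω (Sum.inr (τ e, e')) - ω (Sum.inr (σ e, e'))))) :=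
        Finset.sum_comm
    _ = _ := by
        refine Finset.sum_congr rfl fun e _ => ?_
        rw [sum_mul_dv0 hE (fun y => ω (Sum.inl (e, y)))
          (fun e' => ω (Sum.inr (τ e, e')) - ω (Sum.inr (σ e, e')))]
        refine Finset.sum_congr rfl fun e' _ => ?_
        ring

/-- The final bookkeeping inequality (pure arithmetic). -/
theorem final_arith {N₁ N₂ A₂ B₂ C₂ D₂ DA DB X c : ℝ} (hc : 0 ≤ c)
    (h₁ : N₁ ≤ c * (C₂ + A₂ + DA)) (h₂ : N₂ ≤ c * (D₂ + B₂ + DB))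
    (hA : 0 ≤ A₂) (hB : 0 ≤ B₂) (hC : 0 ≤ C₂) (hD : 0 ≤ D₂) (hDA : 0 ≤ DA) (hDB : 0 ≤ DB) :
    N₁ + N₂ ≤ 10 * c * ((A₂ + B₂ + 2 * X) + DA + DB + (C₂ + D₂ - 2 * X)) := by
  nlinarith [mul_nonneg hc hA, mul_nonneg hc hB, mul_nonneg hc hC, mul_nonneg hc hD,
    mul_nonneg hc hDA, mul_nonneg hc hDB]

/-- **The product step.**  Harmonic parts `hA`, `hB` (constant in the vertex slots) of the two
blocks of a product 1-cochain `ω`, with the Künneth–Poincaré bound; everything is spelled as the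
`let`s `dv`/`dA`/`dB`/`dC`/`Nm`/`Dir` of `KunnethGap` unfold. -/
theorem product_main {k : ℕ} {V E Q : Finset ℕ} {σ τ : ℕ → ℕ} {bd : ℕ → Fin 4 → ℕ × Bool}
    (hS : SqCx V E Q σ τ bd) (hP : Poinc k V E σ τ) (hC : Coh Q bd) (hD : DualPoinc k E Q bd)
    (ω : (ℕ × ℕ) ⊕ (ℕ × ℕ) → ℝ) :
    ∃ hA hB : ℕ → ℝ,
      (∀ q ∈ Q, ∑ i : Fin 4, (if (bd q i).2 then (1 : ℝ) else -1) * hA (bd q i).1 = 0) ∧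
      (∀ q ∈ Q, ∑ i : Fin 4, (if (bd q i).2 then (1 : ℝ) else -1) * hB (bd q i).1 = 0) ∧
      (∀ x ∈ V, (∑ e ∈ E.filter (fun e => τ e = x), hA e) -
        (∑ e ∈ E.filter (fun e => σ e = x), hA e) = 0) ∧
      (∀ y ∈ V, (∑ e ∈ E.filter (fun e => τ e = y), hB e) -
        (∑ e ∈ E.filter (fun e => σ e = y), hB e) = 0) ∧
      (∑ e ∈ E, ∑ y ∈ V, (ω (Sum.inl (e, y)) - hA e) ^ 2) +
          ∑ y ∈ V, ∑ e ∈ E, (ω (Sum.inr (y, e)) - hB e) ^ 2 ≤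
        10 ^ 7 * (k : ℝ) ^ 2 *
          ((∑ x ∈ V, ∑ y ∈ V,
              ((∑ e ∈ E.filter (fun e => τ e = x), ω (Sum.inl (e, y))) -
                  (∑ e ∈ E.filter (fun e => σ e = x), ω (Sum.inl (e, y))) +
                ((∑ e ∈ E.filter (fun e => τ e = y), ω (Sum.inr (x, e))) -
                  ∑ e ∈ E.filter (fun e => σ e = y), ω (Sum.inr (x, e)))) ^ 2) +
            (∑ q ∈ Q, ∑ y ∈ V,
              (∑ i : Fin 4, (if (bd q i).2 then (1 : ℝ) else -1) * ω (Sum.inl ((bd q i).1, y))) ^ 2) +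
            (∑ y ∈ V, ∑ q ∈ Q,
              (∑ i : Fin 4, (if (bd q i).2 then (1 : ℝ) else -1) * ω (Sum.inr (y, (bd q i).1))) ^ 2) +
            ∑ e ∈ E, ∑ e' ∈ E, (ω (Sum.inl (e, σ e')) + ω (Sum.inr (τ e, e')) -
              ω (Sum.inl (e, τ e')) - ω (Sum.inr (σ e, e'))) ^ 2) := by
  have hE : ∀ e ∈ E, σ e ∈ V ∧ τ e ∈ V := fun e he =>
    ⟨((sqCx_elim hS).1 e he).1, ((sqCx_elim hS).1 e he).2.1⟩
  obtain ⟨hA, hdA, hcA, hbA⟩ := block_bound hS hP hC hD fun e y => ω (Sum.inl (e, y))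
  obtain ⟨hB, hdB, hcB, hbB⟩ := block_bound hS hP hC hD fun e y => ω (Sum.inr (y, e))
  refine ⟨hA, hB, hcA, hcB, hdA, hdB, ?_⟩
  -- the atoms
  set N₁ := ∑ e ∈ E, ∑ y ∈ V, (ω (Sum.inl (e, y)) - hA e) ^ 2 with hN₁
  set N₂ := ∑ e ∈ E, ∑ y ∈ V, (ω (Sum.inr (y, e)) - hB e) ^ 2 with hN₂
  set A₂ := ∑ x ∈ V, ∑ y ∈ V, ((∑ e ∈ E.filter (fun e => τ e = x), ω (Sum.inl (e, y))) -
    (∑ e ∈ E.filter (fun e => σ e = x), ω (Sum.inl (e, y)))) ^ 2 with hA₂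
  set B₂ := ∑ x ∈ V, ∑ y ∈ V, ((∑ e ∈ E.filter (fun e => τ e = y), ω (Sum.inr (x, e))) -
    (∑ e ∈ E.filter (fun e => σ e = y), ω (Sum.inr (x, e)))) ^ 2 with hB₂
  set C₂ := ∑ e ∈ E, ∑ e' ∈ E, (ω (Sum.inl (e, τ e')) - ω (Sum.inl (e, σ e'))) ^ 2 with hC₂
  set D₂ := ∑ e ∈ E, ∑ e' ∈ E, (ω (Sum.inr (τ e, e')) - ω (Sum.inr (σ e, e'))) ^ 2 with hD₂
  set DA := ∑ q ∈ Q, ∑ y ∈ V,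
    (∑ i : Fin 4, (if (bd q i).2 then (1 : ℝ) else -1) * ω (Sum.inl ((bd q i).1, y))) ^ 2 with hDA
  set DB := ∑ y ∈ V, ∑ q ∈ Q,
    (∑ i : Fin 4, (if (bd q i).2 then (1 : ℝ) else -1) * ω (Sum.inr (y, (bd q i).1))) ^ 2 with hDB
  set X := ∑ e ∈ E, ∑ e' ∈ E, (ω (Sum.inl (e, τ e')) - ω (Sum.inl (e, σ e'))) *
    (ω (Sum.inr (τ e, e')) - ω (Sum.inr (σ e, e'))) with hX
  -- conversions of the block bounds to the atoms
  have eC : ∑ e ∈ E, ∑ e' ∈ E, (ω (Sum.inl (e, σ e')) - ω (Sum.inl (e, τ e'))) ^ 2 = C₂ :=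
    Finset.sum_congr rfl fun _ _ => Finset.sum_congr rfl fun _ _ => by ring
  have eD : ∑ e ∈ E, ∑ e' ∈ E, (ω (Sum.inr (σ e', e)) - ω (Sum.inr (τ e', e))) ^ 2 = D₂ := by
    rw [hD₂, Finset.sum_comm]
    exact Finset.sum_congr rfl fun _ _ => Finset.sum_congr rfl fun _ _ => by ring
  have eB : ∑ x ∈ V, ∑ y ∈ V, ((∑ e ∈ E.filter (fun e => τ e = x), ω (Sum.inr (y, e))) -
      (∑ e ∈ E.filter (fun e => σ e = x), ω (Sum.inr (y, e)))) ^ 2 = B₂ := by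
    rw [hB₂, Finset.sum_comm]
  have eDB : ∑ q ∈ Q, ∑ y ∈ V,
      (∑ i : Fin 4, (if (bd q i).2 then (1 : ℝ) else -1) * ω (Sum.inr (y, (bd q i).1))) ^ 2 = DB := by
    rw [hDB, Finset.sum_comm]
  have eN₂ : ∑ y ∈ V, ∑ e ∈ E, (ω (Sum.inr (y, e)) - hB e) ^ 2 = N₂ := by
    rw [hN₂, Finset.sum_comm]
  rw [eC] at hbA
  rw [eD, eB, eDB] at hbB
  -- expansion of the two squares with cross terms
  have eDv : ∑ x ∈ V, ∑ y ∈ V,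
      ((∑ e ∈ E.filter (fun e => τ e = x), ω (Sum.inl (e, y))) -
          (∑ e ∈ E.filter (fun e => σ e = x), ω (Sum.inl (e, y))) +
        ((∑ e ∈ E.filter (fun e => τ e = y), ω (Sum.inr (x, e))) -
          ∑ e ∈ E.filter (fun e => σ e = y), ω (Sum.inr (x, e)))) ^ 2 =
      A₂ + B₂ + 2 * ∑ x ∈ V, ∑ y ∈ V,
        ((∑ e ∈ E.filter (fun e => τ e = x), ω (Sum.inl (e, y))) -
            (∑ e ∈ E.filter (fun e => σ e = x), ω (Sum.inl (e, y)))) *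
          ((∑ e ∈ E.filter (fun e => τ e = y), ω (Sum.inr (x, e))) -
            (∑ e ∈ E.filter (fun e => σ e = y), ω (Sum.inr (x, e)))) := by
    rw [hA₂, hB₂, Finset.mul_sum, ← Finset.sum_add_distrib, ← Finset.sum_add_distrib]
    refine Finset.sum_congr rfl fun x _ => ?_
    rw [Finset.mul_sum, ← Finset.sum_add_distrib, ← Finset.sum_add_distrib]
    refine Finset.sum_congr rfl fun y _ => ?_
    ring
  have eDC : ∑ e ∈ E, ∑ e' ∈ E, (ω (Sum.inl (e, σ e')) + ω (Sum.inr (τ e, e')) -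
      ω (Sum.inl (e, τ e')) - ω (Sum.inr (σ e, e'))) ^ 2 = C₂ + D₂ - 2 * X := by
    rw [hC₂, hD₂, hX, Finset.mul_sum, ← Finset.sum_add_distrib, ← Finset.sum_sub_distrib]
    refine Finset.sum_congr rfl fun e _ => ?_
    rw [Finset.mul_sum, ← Finset.sum_add_distrib, ← Finset.sum_sub_distrib]
    refine Finset.sum_congr rfl fun e' _ => ?_
    ring
  rw [eN₂, eDv, eDC, cross_eq hE ω]
  have h10 : (10 : ℝ) ^ 7 * (k : ℝ) ^ 2 = 10 * (10 ^ 6 * (k : ℝ) ^ 2) := by ring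
  rw [h10]
  exact final_arith (by positivity) hbA hbB (by positivity) (by positivity) (by positivity)
    (by positivity) (by positivity) (by positivity)

end Kunneth

/-- **Stub K — THE KÜNNETH–POINCARÉ GAP (finite-dimensional Hodge theory; `G`-free; TRUE; M/L).**
For every well-formed square complex (`SqCx`, clauses 1–3 of `AdmR`) with the primal Poincaré
inequality (`Poinc`, clause 7), coherent orientations and the dual Poincaré inequality, the
product complex `S × S` satisfies `KunnethGap k`: its 1-form Hodge Laplacian has spectral gap
`≥ 10⁻⁷/k²` off the harmonic 1-cochains.  Proof: the factor Hodge gap `Kunneth.hodge_gap`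
(`Poinc` for `im d₀`, `DualPoinc` + `Coh` for `im d₁†`, orthogonal projections in `ℓ²(E)`), then
the product step `Kunneth.product_main` (vertex-slot averaging, the Künneth cross-term identity
`Kunneth.cross_eq`); the harmonic approximant is constant in the vertex slots. -/
theorem stub_kunneth :
    ∀ (k : ℕ) (V E Q : Finset ℕ) (σ τ : ℕ → ℕ) (bd : ℕ → Fin 4 → ℕ × Bool), SqCx V E Q σ τ bd → Poinc k V E σ τ → Coh Q bd → DualPoinc k E Q bd → KunnethGap k V E Q σ τ bd := by
  intro k V E Q σ τ bd hS hP hC hD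
  dsimp only [KunnethGap]
  intro ω
  obtain ⟨hA, hB, hcA, hcB, hdA, hdB, hbd⟩ := Kunneth.product_main hS hP hC hD ω
  refine ⟨Sum.elim (fun p => hA p.1) (fun p => hB p.2), ⟨?_, ?_, ?_, ?_⟩, ?_⟩
  · intro q hq y _
    exact hcA q hq
  · intro y _ q hq
    exact hcB q hq
  · intro e _ e' _
    simp only [Sum.elim_inl, Sum.elim_inr]
    ring
  · intro x hx y hy
    have h1 := hdA x hx
    have h2 := hdB y hy
    simp only [Sum.elim_inl, Sum.elim_inr]
    linarith
  · exact hbd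

end Summit.QuantumFields.YangMills.Cruxes.CurvatureAnchorR.WittenHessian
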